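import Literature.Analysis.FluidPDE.NSGalerkinFourier

/-!
# Route `WazewskiBlock` — objects posited for item stmt-AnomalousDissipation-10354
# (`SubLaminarThreeDTrapAtOneViscosity`): the oblique symmetry class of 3-D Kolmogorov flow

The witnesses for the item are tilted 2.5-D secondary steady states of the Galerkin systems of 3-D
Kolmogorov flow with forcing `F sin(2π·2·x₁) e₀` (`m = 2`). They live in an invariant subspace of
the order-`N` Galerkin phase space `galerkinSubspace (freqBall N)` (Fourier coefficient vectors on
the frequency ball): coefficients supported on the **oblique lattice**
`L = {k ≠ 0, k₀ = k₂, k₁ even}` (fields depending on `(x₀ + x₂, x₁)` only, `x₁`-period `1/2`) and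
**purely imaginary** (`c k ∈ iℝ³`: point symmetry `u ↦ -u(-x)`, sine series). This file fixes the
coordinates of that subspace and the maps the degree argument is run with:

* `obliqueModes N`, `obliqueReps N` — the lattice modes in the ball and a system of representatives
  of `L ∩ ball` modulo `k ↦ -k` (`0 < k₀`, or `k₀ = 0 < k₁`); `ObliqueIndex N = obliqueReps N × Fin 2`.
* `perpVec = (-1,0,1)/√2` (normal to the oblique plane, transversal to every lattice mode) and
  `inVec k = (k₁, -2k₀, k₁)/(√2 |k|)` (the in-plane unit vector transversal to `k = (k₀,k₁,k₀)`);
  `basisVec k σ` (`σ = 0`: in-plane, `σ = 1`: perpendicular).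
* `obliqueCoeff N x` (`Φ`) — the coefficient vector `c` on `freqBall N` with
  `c k = i (x (k,0) inVec k + x (k,1) perpVec)` on representatives, `c (-k) = -c k`, `0` off `L`;
  `obliqueCoord N c` (`Ψ`) — the coordinates `(k,σ) ↦ basisVec k σ · Im (c k)` (a left inverse of `Φ`).
* `kolmogorovCoeff F N` — the Fourier coefficients `∓(iF/2) e₀` at `±(0,2,0)` of the force
  `F sin(4π x₁) e₀`; `obliqueField ν F N = -Ψ ∘ galerkinRHS (freqBall N) ν (kolmogorovCoeff F N) ∘ Φ`
  (`= ` Stokes `+` convection `-` force in coordinates; the Galerkin ODE is `ẋ = -obliqueField x`);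
  `laminarCoord ν F N` — the coordinates of the laminar state `A sin(4πx₁) e₀`, `A = F/(16π²ν)`.
* `repField`, `linMatrix ν F N` — the entrywise formula of the Jacobian matrix of `obliqueField` at
  the laminar state (advection `πA k₀ (h_{k-e} - h_{k+e})` and stretching `2πA (h_{k-e} + h_{k+e})₁ e₀`
  of the laminar shear, read in the polarisation basis); `blockLabel N` — the labelling making it
  block triangular (perpendicular blocks, then in-plane blocks, each by `k₀`).

Only definitions and their unfolding/sanity lemmas are here; the analysis is in the
`WazewskiBlockSubLaminarOblique*.lean` files.
-/

noncomputable section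

-- `Summit.<Summit>.<Problem>` is the tree's mandated summit-side namespace (CONVENTIONS §2); deliberate duplicate.
set_option linter.dupNamespace false

open scoped InnerProductSpace ComplexConjugate
open Finset
open Literature.Analysis.FunctionSpaces Literature.Analysis.FunctionSpaces.Torus
open Literature.Analysis.FluidPDE

namespace Summit.AnomalousDissipation.AnomalousDissipation.Theorems.Oblique

/-! ### The oblique lattice and its representatives -/

/-- The **oblique lattice modes** in the frequency ball of radius `N`: `k ≠ 0` with `k₀ = k₂` and
`k₁` even (Fourier support of fields on `T³` depending on `(x₀ + x₂, x₁)` only and `1/2`-periodic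
in `x₁`). [folklore] -/
def obliqueModes (N : ℕ) : Finset (Fin 3 → ℤ) :=
  (freqBall (d := Fin 3) N).filter fun k => k ≠ 0 ∧ k 0 = k 2 ∧ Even (k 1)

/-- **Representatives** of the oblique lattice modes modulo `k ↦ -k`: `0 < k₀`, or `k₀ = 0` and
`0 < k₁`. [folklore] -/
def obliqueReps (N : ℕ) : Finset (Fin 3 → ℤ) :=
  (obliqueModes N).filter fun k => 0 < k 0 ∨ (k 0 = 0 ∧ 0 < k 1)

/-- The coordinate index type of the oblique class at truncation `N`: a representative mode and a
polarisation (`0`: in-plane, `1`: perpendicular). [folklore] -/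
abbrev ObliqueIndex (N : ℕ) : Type := ↥(obliqueReps N) × Fin 2

/-- Membership in the oblique lattice modes. [folklore] -/
theorem mem_obliqueModes {N : ℕ} {k : Fin 3 → ℤ} :
    k ∈ obliqueModes N ↔ k ∈ freqBall (d := Fin 3) N ∧ k ≠ 0 ∧ k 0 = k 2 ∧ Even (k 1) := by
  simp [obliqueModes]

/-- Membership in the representatives. [folklore] -/
theorem mem_obliqueReps {N : ℕ} {k : Fin 3 → ℤ} :
    k ∈ obliqueReps N ↔ k ∈ obliqueModes N ∧ (0 < k 0 ∨ (k 0 = 0 ∧ 0 < k 1)) := by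
  simp [obliqueReps]

/-- Representatives are lattice modes. [folklore] -/
theorem obliqueReps_subset (N : ℕ) : obliqueReps N ⊆ obliqueModes N := Finset.filter_subset _ _

/-- Lattice modes lie in the frequency ball. [folklore] -/
theorem obliqueModes_subset (N : ℕ) : obliqueModes N ⊆ freqBall (d := Fin 3) N := Finset.filter_subset _ _

/-- Representatives lie in the frequency ball. [folklore] -/
theorem mem_freqBall_of_mem_obliqueReps {N : ℕ} {k : Fin 3 → ℤ} (hk : k ∈ obliqueReps N) :
    k ∈ freqBall (d := Fin 3) N :=
  obliqueModes_subset N (obliqueReps_subset N hk)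

/-- The oblique lattice is symmetric under `k ↦ -k`. [folklore] -/
theorem neg_mem_obliqueModes {N : ℕ} {k : Fin 3 → ℤ} (hk : k ∈ obliqueModes N) : -k ∈ obliqueModes N := by
  rw [mem_obliqueModes] at hk ⊢
  obtain ⟨hb, h0, h02, he⟩ := hk
  refine ⟨neg_mem_freqBall.2 hb, neg_ne_zero.2 h0, by simp [h02], ?_⟩
  simpa using he.neg

/-- Every lattice mode is a representative or the negative of one. [folklore] -/
theorem mem_obliqueReps_or_neg_mem {N : ℕ} {k : Fin 3 → ℤ} (hk : k ∈ obliqueModes N) :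
    k ∈ obliqueReps N ∨ -k ∈ obliqueReps N := by
  have hk' := neg_mem_obliqueModes hk
  obtain ⟨_, h0, h02, _⟩ := mem_obliqueModes.1 hk
  rcases lt_trichotomy (k 0) 0 with h | h | h
  · right; exact mem_obliqueReps.2 ⟨hk', Or.inl (by simp; omega)⟩
  · rcases lt_trichotomy (k 1) 0 with h1 | h1 | h1
    · right; exact mem_obliqueReps.2 ⟨hk', Or.inr ⟨by simp [h], by simp; omega⟩⟩
    · exfalso; apply h0; funext i; fin_cases i <;> simp [h, h1, ← h02]
    · left; exact mem_obliqueReps.2 ⟨hk, Or.inr ⟨h, h1⟩⟩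
  · left; exact mem_obliqueReps.2 ⟨hk, Or.inl h⟩

/-- A representative and its negative are never both representatives. [folklore] -/
theorem not_neg_mem_obliqueReps {N : ℕ} {k : Fin 3 → ℤ} (hk : k ∈ obliqueReps N) : -k ∉ obliqueReps N := by
  intro hk'
  obtain ⟨_, h⟩ := mem_obliqueReps.1 hk
  obtain ⟨_, h'⟩ := mem_obliqueReps.1 hk'
  simp only [Pi.neg_apply, Left.neg_pos_iff, neg_eq_zero] at h'
  omega

/-- The mean mode is not a lattice mode. [folklore] -/
theorem zero_not_mem_obliqueModes (N : ℕ) : (0 : Fin 3 → ℤ) ∉ obliqueModes N := by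
  simp [mem_obliqueModes]

/-! ### The polarisation vectors -/

/-- The unit normal `(-1, 0, 1)/√2` of the oblique plane; it is transversal to every lattice mode
(`k₀ = k₂`). [folklore] -/
def perpVec : EuclideanSpace ℝ (Fin 3) :=
  (Real.sqrt 2)⁻¹ • (EuclideanSpace.single (2 : Fin 3) (1 : ℝ) - EuclideanSpace.single (0 : Fin 3) (1 : ℝ))

/-- The in-plane unit vector `(k₁, -2k₀, k₁)/(√2 |k|)` transversal to the lattice mode
`k = (k₀, k₁, k₀)` (`|k|² = 2k₀² + k₁²`); odd in `k`. [folklore] -/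
def inVec (k : Fin 3 → ℤ) : EuclideanSpace ℝ (Fin 3) :=
  (Real.sqrt 2 * Real.sqrt (freqNormSq k))⁻¹ •
    ((k 1 : ℝ) • EuclideanSpace.single (0 : Fin 3) (1 : ℝ) - (2 * k 0 : ℝ) • EuclideanSpace.single (1 : Fin 3) (1 : ℝ) +
      (k 1 : ℝ) • EuclideanSpace.single (2 : Fin 3) (1 : ℝ))

/-- The polarisation basis at a lattice mode: `σ = 0` in-plane (`inVec k`), `σ = 1` perpendicular
(`perpVec`). [folklore] -/
def basisVec (k : Fin 3 → ℤ) (σ : Fin 2) : EuclideanSpace ℝ (Fin 3) :=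
  if σ = 0 then inVec k else perpVec

/-- Coordinates of `perpVec`. [folklore] -/
theorem perpVec_apply_zero : perpVec 0 = -(Real.sqrt 2)⁻¹ := by simp [perpVec]

/-- Coordinates of `perpVec`. [folklore] -/
theorem perpVec_apply_one : perpVec 1 = 0 := by simp [perpVec]

/-- Coordinates of `perpVec`. [folklore] -/
theorem perpVec_apply_two : perpVec 2 = (Real.sqrt 2)⁻¹ := by simp [perpVec]

/-- Coordinates of `inVec k`. [folklore] -/
theorem inVec_apply_zero (k : Fin 3 → ℤ) :
    inVec k 0 = (Real.sqrt 2 * Real.sqrt (freqNormSq k))⁻¹ * (k 1 : ℝ) := by simp [inVec]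

/-- Coordinates of `inVec k`. [folklore] -/
theorem inVec_apply_one (k : Fin 3 → ℤ) :
    inVec k 1 = (Real.sqrt 2 * Real.sqrt (freqNormSq k))⁻¹ * (-(2 * k 0 : ℝ)) := by
  simp [inVec]

/-- Coordinates of `inVec k`. [folklore] -/
theorem inVec_apply_two (k : Fin 3 → ℤ) :
    inVec k 2 = (Real.sqrt 2 * Real.sqrt (freqNormSq k))⁻¹ * (k 1 : ℝ) := by simp [inVec]

/-- `inVec` is odd: `inVec (-k) = -inVec k` (`|−k| = |k|`). [folklore] -/
theorem inVec_neg (k : Fin 3 → ℤ) : inVec (-k) = -inVec k := by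
  ext j
  fin_cases j
  · simp [inVec_apply_zero, freqNormSq_neg]
  · simp [inVec_apply_one, freqNormSq_neg]
  · simp [inVec_apply_two, freqNormSq_neg]

/-! ### Coordinates of the oblique class -/

/-- **The coefficient vector with oblique coordinates `x`** (`Φ`): on a representative `k`,
`c k = i (x (k,0) inVec k + x (k,1) perpVec)`; on the negative of a representative,
`c (-k) = -c k` (conjugate symmetry of a purely imaginary family); `0` off the lattice.
[folklore] -/
def obliqueCoeff (N : ℕ) (x : ObliqueIndex N → ℝ) : ↥(freqBall (d := Fin 3) N) → EuclideanSpace ℂ (Fin 3) :=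
  fun k =>
    if h : (k : Fin 3 → ℤ) ∈ obliqueReps N then
      Complex.I • EuclideanSpace.complexify (∑ σ : Fin 2, x (⟨(k : Fin 3 → ℤ), h⟩, σ) • basisVec k σ)
    else if h' : -(k : Fin 3 → ℤ) ∈ obliqueReps N then
      -(Complex.I • EuclideanSpace.complexify (∑ σ : Fin 2, x (⟨-(k : Fin 3 → ℤ), h'⟩, σ) • basisVec (-k) σ))
    else 0

/-- **The oblique coordinates of a coefficient vector** (`Ψ`): `(k, σ) ↦ basisVec k σ · Im (c k)`.
On the oblique class this inverts `obliqueCoeff`. [folklore] -/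
def obliqueCoord (N : ℕ) (c : ↥(freqBall (d := Fin 3) N) → EuclideanSpace ℂ (Fin 3)) : ObliqueIndex N → ℝ :=
  fun p => ∑ j : Fin 3, basisVec (p.1 : Fin 3 → ℤ) p.2 j *
    (c ⟨(p.1 : Fin 3 → ℤ), mem_freqBall_of_mem_obliqueReps p.1.2⟩ j).im

/-! ### The Kolmogorov force, the field, the laminar state -/

/-- The forcing wave vector `e = (0, 2, 0)` of the Kolmogorov force `F sin(4π x₁) e₀` (`m = 2`).
[folklore] -/
def modeE : Fin 3 → ℤ := Pi.single (1 : Fin 3) 2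

/-- **Fourier coefficients of the Kolmogorov force** `f = F sin(2π·2·x₁) e₀` on the frequency ball:
`f̂(±e) = ∓(iF/2) e₀`, zero elsewhere (`sin θ = (e^{iθ} - e^{-iθ})/(2i)`). [folklore] -/
def kolmogorovCoeff (F : ℝ) (N : ℕ) : ↥(freqBall (d := Fin 3) N) → EuclideanSpace ℂ (Fin 3) :=
  fun k =>
    if (k : Fin 3 → ℤ) = modeE then
      -(((F / 2 : ℝ) : ℂ) • Complex.I • EuclideanSpace.complexify (EuclideanSpace.single (0 : Fin 3) (1 : ℝ)))
    else if (k : Fin 3 → ℤ) = -modeE then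
      ((F / 2 : ℝ) : ℂ) • Complex.I • EuclideanSpace.complexify (EuclideanSpace.single (0 : Fin 3) (1 : ℝ))
    else 0

/-- **The steady Galerkin map of 3-D Kolmogorov flow in oblique coordinates**:
`obliqueField ν F N = -Ψ ∘ galerkinRHS (freqBall N) ν f̂ ∘ Φ`, i.e. Stokes `+` convection `-`
force; its zeros in the oblique class are the steady Galerkin states of order `N` in the class,
and the Galerkin ODE there reads `ẋ = -obliqueField ν F N x`. [folklore] -/
def obliqueField (ν F : ℝ) (N : ℕ) (x : ObliqueIndex N → ℝ) : ObliqueIndex N → ℝ :=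
  -obliqueCoord N (galerkinRHS (freqBall (d := Fin 3) N) ν (kolmogorovCoeff F N) (obliqueCoeff N x))

/-- **The laminar state in oblique coordinates**: `u_lam = A sin(4π x₁) e₀`, `A = F/(16π²ν)`, has
`û(e) = -(iA/2) e₀`, i.e. coordinates `-A/(2√2)` (in-plane, `inVec e = (1,0,1)/√2`) and `A/(2√2)`
(perpendicular) at the representative `e = (0,2,0)`, and `0` elsewhere. [folklore] -/
def laminarCoord (ν F : ℝ) (N : ℕ) : ObliqueIndex N → ℝ :=
  fun p => if (p.1 : Fin 3 → ℤ) = modeE then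
      (if p.2 = 0 then -(F / (16 * Real.pi ^ 2 * ν)) / (2 * Real.sqrt 2)
        else (F / (16 * Real.pi ^ 2 * ν)) / (2 * Real.sqrt 2))
    else 0

/-- Unfolding of `obliqueField`. [folklore] -/
theorem obliqueField_apply (ν F : ℝ) (N : ℕ) (x : ObliqueIndex N → ℝ) :
    obliqueField ν F N x =
      -obliqueCoord N (galerkinRHS (freqBall (d := Fin 3) N) ν (kolmogorovCoeff F N) (obliqueCoeff N x)) := rfl


/-! ### The linearisation at the laminar state (entry formula) and its block labelling -/

/-- The coefficient field of the coordinate basis vector `q = (k', σ')`: `basisVec k' σ'` at `k'`,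
`-basisVec k' σ'` at `-k'`, zero elsewhere. [folklore] -/
def repField {N : ℕ} (q : ObliqueIndex N) (k : Fin 3 → ℤ) : EuclideanSpace ℝ (Fin 3) :=
  if k = (q.1 : Fin 3 → ℤ) then basisVec (q.1 : Fin 3 → ℤ) q.2
  else if k = -(q.1 : Fin 3 → ℤ) then -basisVec (q.1 : Fin 3 → ℤ) q.2 else 0

/-- **The linearisation of `obliqueField` at the laminar state, entrywise** (`A = F/(16π²ν)`,
`e = (0,2,0)`): for row `p = (k, σ)` and column `q`,
`ν 4π²|k|² δ_{pq} + πA ( k₀ ⟪basisVec k σ, R_q(k-e) - R_q(k+e)⟫ + 2 (R_q(k-e)₁ + R_q(k+e)₁) (basisVec k σ)₀ )`,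
`R_q = repField q` — advection by, and stretching of, the laminar shear. That this IS the Jacobian
matrix of `obliqueField ν F N` at `laminarCoord ν F N` is proved in the analysis files. [folklore] -/
def linMatrix (ν F : ℝ) (N : ℕ) : Matrix (ObliqueIndex N) (ObliqueIndex N) ℝ :=
  Matrix.of fun p q =>
    (if p = q then ν * (4 * Real.pi ^ 2 * freqNormSq (p.1 : Fin 3 → ℤ)) else 0) +
      Real.pi * (F / (16 * Real.pi ^ 2 * ν)) *
        (((p.1 : Fin 3 → ℤ) 0 : ℝ) *
            ⟪basisVec (p.1 : Fin 3 → ℤ) p.2,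
              repField q ((p.1 : Fin 3 → ℤ) - modeE) - repField q ((p.1 : Fin 3 → ℤ) + modeE)⟫_ℝ +
          2 * (repField q ((p.1 : Fin 3 → ℤ) - modeE) 1 + repField q ((p.1 : Fin 3 → ℤ) + modeE) 1) *
            basisVec (p.1 : Fin 3 → ℤ) p.2 0)

/-- **Block labelling** of the oblique coordinates: perpendicular coordinates first (label `0…N`,
by `k₀`), then in-plane coordinates (label `N+1…2N+1`, by `k₀`). With respect to it `linMatrix`
is block (upper) triangular — in-plane rows receive nothing from perpendicular columns, and
different `k₀` never couple — with tridiagonal chains (in `k₁`) as diagonal blocks. [folklore] -/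
def blockLabel (N : ℕ) (p : ObliqueIndex N) : ℕ :=
  (if p.2 = 0 then N + 1 else 0) + ((p.1 : Fin 3 → ℤ) 0).toNat

end Summit.AnomalousDissipation.AnomalousDissipation.Theorems.Oblique

end
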